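import Summits.QuantumFields.BalabanUV.Beta.GAN24.SecondOrderLipschitz

/-!
# `BalabanUV.Beta.GAN24.SecondOrderLipschitzResp` — THE SECOND-ORDER RESPONSE CARRIER IS LIPSCHITZ IN ITS ARGUMENTS, part 3:
# the second-response piece `(μ, y, ν, y′) ↦ dM (K2 ν y′) N S M μ y` is Lipschitz in `(K2, S, M)`, in the FAR form so that both index orders follow
# (G-an2-4 formalisation swarm, leaf prover 03, gen 16; generic engine toward the W-slot's CAUCHY binder `hWall` ∕ `hW₂all`)

NOT IN PRINT; OUR PROOF (elementary).  HONEST FRAMING (cell contract, verbatim): «discharging `BetaPertH` makes Bałaban's UV stability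
UNCONDITIONAL — a real constructive-QFT result; it is NOT the continuum limit and NOT the Clay problem.»  HONEST DEPENDENCY (verbatim):
«continuum YM on T⁴ ⇐ BetaPertH ∧ nine spine estimates (0/9 proved); BetaPertH ⇐ (D1) ∧ (D4) ∧ CAP+tail; G-an2-4 gates asym, D1 and
NE2/3/4.»

WHAT ([folklore]; continuation of `GAN24/SecondOrderLipschitz`).  For vertex families `K2, K2′` (`VertexFamily · N C₂ m`, deviation `ε₂`) in the role
of the derivative of the inverse (an2's `K2OfK`, Lipschitz by `SecondOrderLipschitz.vertexFamily_K2OfK_sub`) and first tables `S, S′` (`LocStencil · Cs m`,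
deviation `εS`), `M, M′` (`VertexFamily · N CM m`, deviation `εM`):
* `biLoc_vertexOfK_of_biLoc_sub` (asym1's `HessKerRate.biLoc_wsum_sub_wsum` with an2's `abs_colH_le_of_biLoc` weights), `biLoc_vertexOfM_of_biLoc_sub`
  (telescoping `cwsum_sub_cwsum_bdd`, `InterLevelTransport.biLoc_cwsum` twice) — the chain-rule vertices through BI-LOCALISED kernels are Lipschitz;
* `biLoc_resp_sub_far` — `dM (K2 ν y′) N S M μ y − dM (K2′ ν y′) N S′ M′ μ y` is bi-localised at `(N•y′, N•y′)` with constant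
  `ldM d C₂ Cs CM ε₂ εS εM m · e^{−m|N•y − N•y′|}`, rate `m/2`;
* `vertexFamily₂_resp_sub`, `vertexFamily₂_resp_swap_sub` — both index orders by `biLoc_recenter_left` ∕ `biLoc_recenter_right` (an2's
  `vertexFamily₂_resp` ∕ `vertexFamily₂_resp_swap` with one factor a deviation; constant `ldM`, LINEAR in `(ε₂, εS, εM)`).

HONEST: generic kernel algebra over an2's carriers; instantiates NO binder of the wall, asserts NO shape of Bałaban's tables, discharges NOTHING of
(hW, hWall); NOT «W-slot closed», NEVER «G-an2-4 closed»; NOT BetaPertH, NOT continuum, NOT Clay.  0 sorry, 0 cite, 0 `def`.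
-/

noncomputable section

open Finset
open scoped BigOperators
open Literature.MathematicalPhysics.QuantumFieldTheory
open Literature.MathematicalPhysics.QuantumFieldTheory.Balaban1983to89
open Literature.MathematicalPhysics.QuantumFieldTheory.Balaban1983to89.Beta
open B12Sec2to5 (l1 l1_nonneg)
open ExpKernelCalculus (MKer Decays BiLoc VertexFamily VertexFamily₂ Zl Zl_nonneg l1_sub_symm)
open OneStepResolventKernel (Fib LocStencil wsum bound_mono biLoc_mono)
open OneStepKernelFamily (colH abs_colH_le vertexOfK)
open InterLevelTransport (cwsum biLoc_cwsum)
open KernelWard (bdd_of_biLoc biLoc_add)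
open HessKerRate (colH_sub biLoc_wsum_sub_wsum)
open BalabanCompositeJets (LocStencil₂ biLoc_wsum_far)
open SecondOrderResponse (colM abs_colM_le vertexOfM dM vertex2OfK mixOfK LocStencilFM biLoc_cwsum_far biLoc_wsum_self_far
  biLoc_recenter_left biLoc_recenter_right abs_colH_le_of_biLoc abs_colM_le_of_biLoc biLoc_vertexOfK_slice biLoc_vertexOfM_slice)
open Summit.QuantumFields.BalabanUV.Beta.GAN24.SecondOrderLipschitz (wsum_sub_wsum_bdd cwsum_sub_cwsum_bdd mul_exp_neg_le abs_le_of_biLoc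
  colM_sub ldM ldM_nonneg)

namespace Summit.QuantumFields.BalabanUV.Beta.GAN24.SecondOrderLipschitzResp

variable {d : ℕ} {N : ℕ} [NeZero N]

/-! ## The second-response piece is Lipschitz (far form ⟹ both index orders) -/

section Resp

omit [NeZero N] in
/-- [folklore] The field-column vertex through BI-LOCALISED kernels `K₂, K₂′` at `(q, q)` (constant `C₂`, deviation `ε₂`) of local stencil families
`S, S′` (constant `Cs`, deviation `εS`) is Lipschitz: bi-localised at `(q, q)` with constant `(d+1)·((ε₂·Cs + C₂·εS)·Zl(m/2))·e^{−m|N•y − q|}`, rate `m/2`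
(asym1's `HessKerRate.biLoc_wsum_sub_wsum` with an2's `abs_colH_le_of_biLoc` weights). -/
theorem biLoc_vertexOfK_of_biLoc_sub {K₂ K₂' : MKer (d + 1) (Fib d)} {q : Fin (d + 1) → ℤ} {C₂ ε₂ m : ℝ}
    (hK₂ : BiLoc K₂ q q C₂ m) (hK₂' : BiLoc K₂' q q C₂ m) (hKK₂ : BiLoc (K₂ - K₂') q q ε₂ m)
    {S S' : Fin (d + 1) → (Fin (d + 1) → ℤ) → MKer (d + 1) (Fib d)} {Cs εS : ℝ}
    (hS : LocStencil S Cs m) (hS' : LocStencil S' Cs m) (hSS : LocStencil (S - S') εS m) (hm : 0 < m)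
    (μ : Fin (d + 1)) (y : Fin (d + 1) → ℤ) :
    BiLoc (vertexOfK K₂ N S μ y - vertexOfK K₂' N S' μ y) q q
      ((d + 1 : ℕ) * ((ε₂ * Cs + C₂ * εS) * Zl (d + 1) (m / 2) * Real.exp (-m * l1 ((N : ℤ) • y - q)))) (m / 2) := by
  have hC₂ : 0 ≤ C₂ := hK₂.nonneg (Sum.inl 0)
  have hε₂ : 0 ≤ ε₂ := hKK₂.nonneg (Sum.inl 0)
  have hC₂e : 0 ≤ C₂ * Real.exp (-m * l1 ((N : ℤ) • y - q)) := mul_nonneg hC₂ (Real.exp_pos _).le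
  have hε₂e : 0 ≤ ε₂ * Real.exp (-m * l1 ((N : ℤ) • y - q)) := mul_nonneg hε₂ (Real.exp_pos _).le
  have hww : ∀ (κ : Fin (d + 1)) (u : Fin (d + 1) → ℤ), |colH K₂ N μ y κ u - colH K₂' N μ y κ u|
      ≤ ε₂ * Real.exp (-m * l1 ((N : ℤ) • y - q)) * Real.exp (-m * l1 (u - q)) := fun κ u => by
    rw [← colH_sub]
    exact abs_colH_le_of_biLoc (N := N) hKK₂ μ y κ u
  have hterm : ∀ κ : Fin (d + 1), BiLoc (wsum (colH K₂ N μ y κ) (S κ) - wsum (colH K₂' N μ y κ) (S' κ)) q q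
      ((ε₂ * Real.exp (-m * l1 ((N : ℤ) • y - q)) * Cs + C₂ * Real.exp (-m * l1 ((N : ℤ) • y - q)) * εS) * Zl (d + 1) (m / 2))
      (m / 2) := fun κ =>
    biLoc_wsum_sub_wsum (fun u => abs_colH_le_of_biLoc (N := N) hK₂ μ y κ u) (fun u => abs_colH_le_of_biLoc (N := N) hK₂' μ y κ u)
      (hww κ) (fun u => hS κ u) (fun u => hS' κ u) (fun u => hSS κ u) hm hC₂e hC₂e hε₂e
  have hsum := OneStepResolventKernel.biLoc_finset_sum (Finset.univ : Finset (Fin (d + 1))) (fun κ _ => hterm κ)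
  simp only [Finset.sum_const, Finset.card_univ, Fintype.card_fin, nsmul_eq_mul] at hsum
  have e : (d + 1 : ℕ) * ((ε₂ * Cs + C₂ * εS) * Zl (d + 1) (m / 2) * Real.exp (-m * l1 ((N : ℤ) • y - q)))
      = (d + 1 : ℕ) * ((ε₂ * Real.exp (-m * l1 ((N : ℤ) • y - q)) * Cs + C₂ * Real.exp (-m * l1 ((N : ℤ) • y - q)) * εS)
          * Zl (d + 1) (m / 2)) := by ring
  rw [e]
  intro x z a b
  have h := hsum x z a b
  simpa only [vertexOfK, Pi.sub_apply, Finset.sum_sub_distrib] using h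

/-- [folklore] The multiplier-column vertex through bi-localised kernels `K₂, K₂′` at `(q, q)` of coarse-localised tables `M, M′` is Lipschitz: same
shape (telescoping `cwsum_sub_cwsum_bdd`, `InterLevelTransport.biLoc_cwsum` twice). -/
theorem biLoc_vertexOfM_of_biLoc_sub {K₂ K₂' : MKer (d + 1) (Fib d)} {q : Fin (d + 1) → ℤ} {C₂ ε₂ m : ℝ}
    (hK₂ : BiLoc K₂ q q C₂ m) (hK₂' : BiLoc K₂' q q C₂ m) (hKK₂ : BiLoc (K₂ - K₂') q q ε₂ m)
    {M M' : Fin (d + 1) → (Fin (d + 1) → ℤ) → MKer (d + 1) (Fib d)} {CM εM : ℝ}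
    (hM : VertexFamily M N CM m) (hM' : VertexFamily M' N CM m) (hMM : VertexFamily (M - M') N εM m) (hm : 0 < m)
    (μ : Fin (d + 1)) (y : Fin (d + 1) → ℤ) :
    BiLoc (vertexOfM K₂ N M μ y - vertexOfM K₂' N M' μ y) q q
      ((d + 1 : ℕ) * ((ε₂ * CM + C₂ * εM) * Zl (d + 1) (m / 2) * Real.exp (-m * l1 ((N : ℤ) • y - q)))) (m / 2) := by
  have hC₂ : 0 ≤ C₂ := hK₂.nonneg (Sum.inl 0)
  have hε₂ : 0 ≤ ε₂ := hKK₂.nonneg (Sum.inl 0)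
  have hCM : 0 ≤ CM := (hM 0 0).nonneg (Sum.inl 0)
  have hC₂e : 0 ≤ C₂ * Real.exp (-m * l1 ((N : ℤ) • y - q)) := mul_nonneg hC₂ (Real.exp_pos _).le
  have hε₂e : 0 ≤ ε₂ * Real.exp (-m * l1 ((N : ℤ) • y - q)) := mul_nonneg hε₂ (Real.exp_pos _).le
  have hw : ∀ (ρ : Fin (d + 1)) (w : Fin (d + 1) → ℤ), |colM K₂ N μ y ρ w|
      ≤ C₂ * Real.exp (-m * l1 ((N : ℤ) • y - q)) * Real.exp (-m * l1 ((N : ℤ) • w - q)) :=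
    fun ρ w => abs_colM_le_of_biLoc (N := N) hK₂ μ y ρ w
  have hw' : ∀ (ρ : Fin (d + 1)) (w : Fin (d + 1) → ℤ), |colM K₂' N μ y ρ w|
      ≤ C₂ * Real.exp (-m * l1 ((N : ℤ) • y - q)) * Real.exp (-m * l1 ((N : ℤ) • w - q)) :=
    fun ρ w => abs_colM_le_of_biLoc (N := N) hK₂' μ y ρ w
  have hww : ∀ (ρ : Fin (d + 1)) (w : Fin (d + 1) → ℤ), |(colM K₂ N μ y ρ - colM K₂' N μ y ρ) w|
      ≤ ε₂ * Real.exp (-m * l1 ((N : ℤ) • y - q)) * Real.exp (-m * l1 ((N : ℤ) • w - q)) := fun ρ w => by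
    rw [Pi.sub_apply, ← colM_sub]
    exact abs_colM_le_of_biLoc (N := N) hKK₂ μ y ρ w
  have hb : ∀ (ρ : Fin (d + 1)) (w x z : Fin (d + 1) → ℤ) (a b : Fib d), |M ρ w x z a b| ≤ CM := fun ρ w x z a b =>
    bdd_of_biLoc (hM ρ w) hm.le x z a b
  have hb' : ∀ (ρ : Fin (d + 1)) (w x z : Fin (d + 1) → ℤ) (a b : Fib d), |M' ρ w x z a b| ≤ CM := fun ρ w x z a b =>
    bdd_of_biLoc (hM' ρ w) hm.le x z a b
  have hterm : ∀ ρ : Fin (d + 1), BiLoc (cwsum N (colM K₂ N μ y ρ) (M ρ) - cwsum N (colM K₂' N μ y ρ) (M' ρ)) q q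
      ((ε₂ * Real.exp (-m * l1 ((N : ℤ) • y - q)) * CM + C₂ * Real.exp (-m * l1 ((N : ℤ) • y - q)) * εM) * Zl (d + 1) (m / 2))
      (m / 2) := by
    intro ρ
    rw [cwsum_sub_cwsum_bdd (hw ρ) (hw' ρ) hm hC₂e hC₂e (hb ρ) (hb' ρ) hCM hCM]
    have h1 : BiLoc (cwsum N (colM K₂ N μ y ρ - colM K₂' N μ y ρ) (M ρ)) q q
        (ε₂ * Real.exp (-m * l1 ((N : ℤ) • y - q)) * CM * Zl (d + 1) (m / 2)) (m / 2) :=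
      biLoc_cwsum (hww ρ) (fun w => hM ρ w) hm hε₂e
    have h2 : BiLoc (cwsum N (colM K₂' N μ y ρ) (M ρ - M' ρ)) q q
        (C₂ * Real.exp (-m * l1 ((N : ℤ) • y - q)) * εM * Zl (d + 1) (m / 2)) (m / 2) :=
      biLoc_cwsum (hw' ρ) (fun w => hMM ρ w) hm hC₂e
    have h := biLoc_add h1 h2
    intro x z a b
    refine (h x z a b).trans (le_of_eq ?_)
    ring
  have hsum := OneStepResolventKernel.biLoc_finset_sum (Finset.univ : Finset (Fin (d + 1))) (fun ρ _ => hterm ρ)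
  simp only [Finset.sum_const, Finset.card_univ, Fintype.card_fin, nsmul_eq_mul] at hsum
  have e : (d + 1 : ℕ) * ((ε₂ * CM + C₂ * εM) * Zl (d + 1) (m / 2) * Real.exp (-m * l1 ((N : ℤ) • y - q)))
      = (d + 1 : ℕ) * ((ε₂ * Real.exp (-m * l1 ((N : ℤ) • y - q)) * CM + C₂ * Real.exp (-m * l1 ((N : ℤ) • y - q)) * εM)
          * Zl (d + 1) (m / 2)) := by ring
  rw [e]
  intro x z a b
  have h := hsum x z a b
  simpa only [vertexOfM, Pi.sub_apply, Finset.sum_sub_distrib] using h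

/-- [folklore] **THE SECOND-RESPONSE PIECE IS LIPSCHITZ, FAR FORM**: for vertex families `K2, K2′` (constant `C₂`, deviation `ε₂`, rate `m`) in the role
of the derivative of the inverse and first tables with deviations `εS`, `εM`, the difference `dM (K2 ν y′) N S M μ y − dM (K2′ ν y′) N S′ M′ μ y` is
bi-localised at `(N•y′, N•y′)` with constant `ldM d C₂ Cs CM ε₂ εS εM m · e^{−m|N•y − N•y′|}`, rate `m/2`. -/
theorem biLoc_resp_sub_far {K2 K2' : Fin (d + 1) → (Fin (d + 1) → ℤ) → MKer (d + 1) (Fib d)} {C₂ ε₂ m : ℝ}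
    (hK2 : VertexFamily K2 N C₂ m) (hK2' : VertexFamily K2' N C₂ m) (hKK2 : VertexFamily (K2 - K2') N ε₂ m)
    {S S' : Fin (d + 1) → (Fin (d + 1) → ℤ) → MKer (d + 1) (Fib d)} {Cs εS : ℝ}
    {M M' : Fin (d + 1) → (Fin (d + 1) → ℤ) → MKer (d + 1) (Fib d)} {CM εM : ℝ}
    (hS : LocStencil S Cs m) (hS' : LocStencil S' Cs m) (hSS : LocStencil (S - S') εS m)
    (hM : VertexFamily M N CM m) (hM' : VertexFamily M' N CM m) (hMM : VertexFamily (M - M') N εM m) (hm : 0 < m)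
    (μ : Fin (d + 1)) (y : Fin (d + 1) → ℤ) (ν : Fin (d + 1)) (y' : Fin (d + 1) → ℤ) :
    BiLoc (dM (K2 ν y') N S M μ y - dM (K2' ν y') N S' M' μ y) ((N : ℤ) • y') ((N : ℤ) • y')
      (ldM d C₂ Cs CM ε₂ εS εM m * Real.exp (-m * l1 ((N : ℤ) • y - (N : ℤ) • y'))) (m / 2) := by
  have h1 := biLoc_vertexOfK_of_biLoc_sub (N := N) (hK2 ν y') (hK2' ν y') (hKK2 ν y') hS hS' hSS hm μ y
  have h2 := biLoc_vertexOfM_of_biLoc_sub (N := N) (hK2 ν y') (hK2' ν y') (hKK2 ν y') hM hM' hMM hm μ y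
  have h := biLoc_add h1 h2
  intro x z a b
  have hx := h x z a b
  have e : (dM (K2 ν y') N S M μ y - dM (K2' ν y') N S' M' μ y) x z a b
      = ((vertexOfK (K2 ν y') N S μ y - vertexOfK (K2' ν y') N S' μ y)
          + (vertexOfM (K2 ν y') N M μ y - vertexOfM (K2' ν y') N M' μ y)) x z a b := by
    simp only [dM, Pi.sub_apply, Pi.add_apply]
    ring
  rw [e]
  refine hx.trans (le_of_eq ?_)
  unfold ldM
  ring

/-- [folklore] **THE SECOND-RESPONSE PIECE IS LIPSCHITZ**: `VertexFamily₂ (fun μ y ν y′ ↦ dM (K2 ν y′) N S M μ y − dM (K2′ ν y′) N S′ M′ μ y) N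
(ldM d C₂ Cs CM ε₂ εS εM m) (m/2)` (far form, first leg re-centred — an2's `vertexFamily₂_resp` with one factor a deviation). -/
theorem vertexFamily₂_resp_sub {K2 K2' : Fin (d + 1) → (Fin (d + 1) → ℤ) → MKer (d + 1) (Fib d)} {C₂ ε₂ m : ℝ}
    (hK2 : VertexFamily K2 N C₂ m) (hK2' : VertexFamily K2' N C₂ m) (hKK2 : VertexFamily (K2 - K2') N ε₂ m)
    {S S' : Fin (d + 1) → (Fin (d + 1) → ℤ) → MKer (d + 1) (Fib d)} {Cs εS : ℝ}
    {M M' : Fin (d + 1) → (Fin (d + 1) → ℤ) → MKer (d + 1) (Fib d)} {CM εM : ℝ}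
    (hS : LocStencil S Cs m) (hS' : LocStencil S' Cs m) (hSS : LocStencil (S - S') εS m)
    (hM : VertexFamily M N CM m) (hM' : VertexFamily M' N CM m) (hMM : VertexFamily (M - M') N εM m) (hm : 0 < m) :
    VertexFamily₂ (fun μ y ν y' => dM (K2 ν y') N S M μ y - dM (K2' ν y') N S' M' μ y) N (ldM d C₂ Cs CM ε₂ εS εM m) (m / 2) := by
  intro μ y ν y'
  have h := biLoc_resp_sub_far hK2 hK2' hKK2 hS hS' hSS hM hM' hMM hm μ y ν y'
  exact biLoc_recenter_left h (ldM_nonneg ((hK2 0 0).nonneg (Sum.inl 0)) ((hS 0 0).nonneg (Sum.inl 0)) ((hM 0 0).nonneg (Sum.inl 0))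
    ((hKK2 0 0).nonneg (Sum.inl 0)) ((hSS 0 0).nonneg (Sum.inl 0)) ((hMM 0 0).nonneg (Sum.inl 0)) hm) (half_pos hm).le (by linarith)

/-- [folklore] **THE EXCHANGED SECOND-RESPONSE PIECE IS LIPSCHITZ**: `(μ, y, ν, y′) ↦ dM (K2 μ y) N S M ν y′ − dM (K2′ μ y) N S′ M′ ν y′`, constant
`ldM`, rate `m/2` (far form, second leg re-centred — an2's `vertexFamily₂_resp_swap` with one factor a deviation). -/
theorem vertexFamily₂_resp_swap_sub {K2 K2' : Fin (d + 1) → (Fin (d + 1) → ℤ) → MKer (d + 1) (Fib d)} {C₂ ε₂ m : ℝ}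
    (hK2 : VertexFamily K2 N C₂ m) (hK2' : VertexFamily K2' N C₂ m) (hKK2 : VertexFamily (K2 - K2') N ε₂ m)
    {S S' : Fin (d + 1) → (Fin (d + 1) → ℤ) → MKer (d + 1) (Fib d)} {Cs εS : ℝ}
    {M M' : Fin (d + 1) → (Fin (d + 1) → ℤ) → MKer (d + 1) (Fib d)} {CM εM : ℝ}
    (hS : LocStencil S Cs m) (hS' : LocStencil S' Cs m) (hSS : LocStencil (S - S') εS m)
    (hM : VertexFamily M N CM m) (hM' : VertexFamily M' N CM m) (hMM : VertexFamily (M - M') N εM m) (hm : 0 < m) :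
    VertexFamily₂ (fun μ y ν y' => dM (K2 μ y) N S M ν y' - dM (K2' μ y) N S' M' ν y') N (ldM d C₂ Cs CM ε₂ εS εM m) (m / 2) := by
  intro μ y ν y'
  have h := biLoc_resp_sub_far hK2 hK2' hKK2 hS hS' hSS hM hM' hMM hm ν y' μ y
  exact biLoc_recenter_right h (ldM_nonneg ((hK2 0 0).nonneg (Sum.inl 0)) ((hS 0 0).nonneg (Sum.inl 0)) ((hM 0 0).nonneg (Sum.inl 0))
    ((hKK2 0 0).nonneg (Sum.inl 0)) ((hSS 0 0).nonneg (Sum.inl 0)) ((hMM 0 0).nonneg (Sum.inl 0)) hm) (half_pos hm).le (by linarith)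

end Resp

end Summit.QuantumFields.BalabanUV.Beta.GAN24.SecondOrderLipschitzResp

end
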